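import Mathlib
import Literature.MathematicalPhysics.QuantumLattice.WilsonDiracAP
import Summits.QuantumFields.QCD.Theorems.QuarksAsStableActionWilsonQuarkStabilityTangentDelta

/-!
# Frobenius and operator bounds for `Δ = D₂[u·X] − D₂[u]` (Wilson–Dirac, direction-dependent constant
unitaries) — helper for crux stmt-QuantumFields-9734, line `Sketch`, stub `stub_deltaBounds`

What.  On `(ℤ/L)⁴` (used at `L = 2`), colour `Fin 3`, spin `Fin 4`, `r = 1`, mass `m`: for constant
direction-dependent `u : Fin 4 → U(3)` and any `U(3)` link field `X`, the perturbation
`Δ = wilsonDirac ρ₃ (fun e => u e.2 * X e) m 1 − wilsonDirac ρ₃ (fun e => u e.2) m 1` satisfies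
(F) `Σ_{pq} ‖Δ_{pq}‖² ≤ 64 Σ_e (3 − Re tr X_e)` and (op) `Σ_p ‖(Δ v)_p‖² ≤ 256 η Σ_p ‖v_p‖²` whenever
every link deficit `3 − Re tr X_e ≤ η`; `stub_deltaBounds` is the existential form (`C_F = 64`,
`C_op = 256`).

How.  The mass/Wilson diagonal cancels (`wilsonDirac_dir_sub_apply`): `Δ_{pq} = −½ Σ_μ (F_μ + B_μ)`
with hops `F_μ(p,q) = [q.1 = p.1 + e_μ] (1 − γ_μ)_{p₂q₂} (u_μ (X_{p.1,μ} − 1))_{p₁q₁}`,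
`B_μ(p,q) = [p.1 = q.1 + e_μ] (1 + γ_μ)_{p₂q₂} ((u_μ (X_{q.1,μ} − 1))ᴴ)_{p₁q₁}`; the colour factors
have Frobenius sum `2 (3 − Re tr X_e)` (unitary invariance + the sibling's `sum_norm_sq_sub_one`), the
spin factors `‖1 ∓ γ_μ‖_F² = 8` (sibling `sum_norm_sq_one_add_smul_gamma`).  With
`‖−½ Σ_μ (a_μ + b_μ)‖² ≤ 2 Σ_μ (‖a_μ‖² + ‖b_μ‖²)`: (F) sums the Kronecker blocks
(`Σ ‖G_{αβ} C_{ab}‖² = ‖G‖_F² ‖C‖_F² = 16 d_e`) over the `4 + 4` hops; (op) is blockwise Cauchy–Schwarz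
`Σ_t ‖Σ_s G_{t₂s₂} C_{t₁s₁} w_s‖² ≤ ‖G‖_F² ‖C‖_F² ‖w‖² ≤ 16 η ‖w‖²` plus re-indexing of the translated
site sums.  Generic kernel versions (`frob_kernel_le`, `op_kernel_le`) come first.
References: Montvay–Münster, *Quantum Fields on a Lattice* §4.2 (Wilson–Dirac operator); folklore
linear algebra; pattern: sibling `…WilsonQuarkStabilityTangentDelta`.  Pure theorem file (no `def`s).
-/

noncomputable section

open scoped BigOperators Classical Matrix ComplexConjugate
open Finset
open Literature.MathematicalPhysics.QuantumLattice Literature.MathematicalPhysics.QuantumFieldTheory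
  Literature.Probability.LatticeModels

namespace Summit.QuantumFields.QCD.Cruxes.CriticalLineDiamagnetism.ChessboardCellGain

open Summit.QuantumFields.QCD.Cruxes.WilsonQuarkStability.FreeTangentLandauChessboard

namespace StubDeltaBounds

variable {L : ℕ}

/-- **Entries of the perturbation** `Δ = D[u·X] − D[u]`: the diagonal (mass + Wilson) part cancels
and the hopping blocks subtract. -/
theorem wilsonDirac_dir_sub_apply (u : Fin 4 → Matrix.unitaryGroup (Fin 3) ℂ)
    (X : GaugeConfig 4 L (Matrix.unitaryGroup (Fin 3) ℂ)) (m : ℝ)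
    (p q : TorusSite 4 L × Fin 3 × Fin 4) :
    (wilsonDirac (unitaryFundamentalRep (Fin 3) ℂ) (fun e : Edge 4 L => u e.2 * X e) m 1 -
        wilsonDirac (unitaryFundamentalRep (Fin 3) ℂ) (fun e : Edge 4 L => u e.2) m 1) p q =
      -(1 / 2 : ℂ) * ∑ μ : Fin 4,
        ((if q.1 = Site.shift p.1 μ then
            ((1 : Matrix (Fin 4) (Fin 4) ℂ) - euclideanGamma μ) p.2.2 q.2.2 *
              (unitaryFundamentalRep (Fin 3) ℂ (u μ * X (p.1, μ)) -
                unitaryFundamentalRep (Fin 3) ℂ (u μ)) p.2.1 q.2.1 else 0) +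
          (if p.1 = Site.shift q.1 μ then
            ((1 : Matrix (Fin 4) (Fin 4) ℂ) + euclideanGamma μ) p.2.2 q.2.2 *
              (unitaryFundamentalRep (Fin 3) ℂ (u μ * X (q.1, μ))⁻¹ -
                unitaryFundamentalRep (Fin 3) ℂ (u μ)⁻¹) p.2.1 q.2.1 else 0)) := by
  rw [Matrix.sub_apply]
  simp only [wilsonDirac, Matrix.of_apply, Complex.ofReal_one, one_smul]
  rw [sub_sub_sub_cancel_left, ← mul_sub, ← Finset.sum_sub_distrib, neg_mul, ← mul_neg,
    ← Finset.sum_neg_distrib]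
  refine congrArg₂ (· * ·) rfl (Finset.sum_congr rfl fun μ _ => ?_)
  split_ifs <;> (try simp only [Matrix.sub_apply, mul_sub]) <;> ring

/-- Left multiplication by a unitary preserves the Frobenius sum. -/
theorem sum_norm_sq_unitary_mul (u : Matrix.unitaryGroup (Fin 3) ℂ) (M : Matrix (Fin 3) (Fin 3) ℂ) :
    ∑ a, ∑ b, ‖((u : Matrix (Fin 3) (Fin 3) ℂ) * M) a b‖ ^ 2 = ∑ a, ∑ b, ‖M a b‖ ^ 2 := by
  rw [sum_norm_sq_eq_re_trace_conjTranspose_mul_self,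
    sum_norm_sq_eq_re_trace_conjTranspose_mul_self, Matrix.conjTranspose_mul, Matrix.mul_assoc,
    ← Matrix.mul_assoc _ (u : Matrix (Fin 3) (Fin 3) ℂ) M,
    show (u : Matrix (Fin 3) (Fin 3) ℂ)ᴴ * (u : Matrix (Fin 3) (Fin 3) ℂ) = 1 from
      Matrix.UnitaryGroup.star_mul_self u, Matrix.one_mul]

/-- The Frobenius sum is invariant under the conjugate transpose. -/
theorem sum_norm_sq_star (M : Matrix (Fin 3) (Fin 3) ℂ) :
    ∑ a, ∑ b, ‖(star M) a b‖ ^ 2 = ∑ a, ∑ b, ‖M a b‖ ^ 2 := by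
  rw [Finset.sum_comm]
  simp only [Matrix.star_apply, norm_star]

/-- Forward colour factor: `ρ(u g) − ρ(u) = u (g − 1)` has Frobenius sum `2 (3 − Re tr g)`. -/
theorem sum_norm_sq_rep_mul_sub (u g : Matrix.unitaryGroup (Fin 3) ℂ) :
    ∑ a, ∑ b, ‖(unitaryFundamentalRep (Fin 3) ℂ (u * g) -
        unitaryFundamentalRep (Fin 3) ℂ u) a b‖ ^ 2 =
      2 * (3 - ((g : Matrix (Fin 3) (Fin 3) ℂ)).trace.re) := by
  have : unitaryFundamentalRep (Fin 3) ℂ (u * g) - unitaryFundamentalRep (Fin 3) ℂ u =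
      (u : Matrix (Fin 3) (Fin 3) ℂ) * ((g : Matrix (Fin 3) (Fin 3) ℂ) - 1) := by
    simp only [unitaryFundamentalRep_apply, Matrix.UnitaryGroup.mul_val]
    rw [Matrix.mul_sub, Matrix.mul_one]
  rw [this, sum_norm_sq_unitary_mul, sum_norm_sq_sub_one]

/-- Backward colour factor: `ρ((u g)⁻¹) − ρ(u⁻¹) = (u (g − 1))ᴴ` has Frobenius sum `2 (3 − Re tr g)`. -/
theorem sum_norm_sq_rep_mul_inv_sub (u g : Matrix.unitaryGroup (Fin 3) ℂ) :
    ∑ a, ∑ b, ‖(unitaryFundamentalRep (Fin 3) ℂ (u * g)⁻¹ -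
        unitaryFundamentalRep (Fin 3) ℂ u⁻¹) a b‖ ^ 2 =
      2 * (3 - ((g : Matrix (Fin 3) (Fin 3) ℂ)).trace.re) := by
  have : unitaryFundamentalRep (Fin 3) ℂ (u * g)⁻¹ - unitaryFundamentalRep (Fin 3) ℂ u⁻¹ =
      star ((u : Matrix (Fin 3) (Fin 3) ℂ) * ((g : Matrix (Fin 3) (Fin 3) ℂ) - 1)) := by
    simp only [unitaryFundamentalRep_apply, Matrix.UnitaryGroup.inv_val,
      Matrix.UnitaryGroup.mul_val]
    rw [Matrix.mul_sub, Matrix.mul_one, star_sub]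
  rw [this, sum_norm_sq_star, sum_norm_sq_unitary_mul, sum_norm_sq_sub_one]

/-- `Σ_{αβ} ‖(1 − γ_μ)_{αβ}‖² = 8`. -/
theorem sum_norm_sq_one_sub_gamma (μ : Fin 4) :
    ∑ α, ∑ β, ‖((1 : Matrix (Fin 4) (Fin 4) ℂ) - euclideanGamma μ) α β‖ ^ 2 = 8 := by
  simpa [sub_eq_add_neg] using sum_norm_sq_one_add_smul_gamma μ (-1) (Or.inr rfl)

/-- `Σ_{αβ} ‖(1 + γ_μ)_{αβ}‖² = 8`. -/
theorem sum_norm_sq_one_add_gamma (μ : Fin 4) :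
    ∑ α, ∑ β, ‖((1 : Matrix (Fin 4) (Fin 4) ℂ) + euclideanGamma μ) α β‖ ^ 2 = 8 := by
  simpa using sum_norm_sq_one_add_smul_gamma μ 1 (Or.inl rfl)

/-- `‖−½ Σ_μ (a_μ + b_μ)‖² ≤ 2 Σ_μ (‖a_μ‖² + ‖b_μ‖²)` (eight terms). -/
theorem norm_sq_half_sum_le (a b : Fin 4 → ℂ) :
    ‖-(1 / 2 : ℂ) * ∑ μ, (a μ + b μ)‖ ^ 2 ≤ 2 * ∑ μ, (‖a μ‖ ^ 2 + ‖b μ‖ ^ 2) := by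
  have h0 : ‖-(1 / 2 : ℂ) * ∑ μ, (a μ + b μ)‖ = 1 / 2 * ‖∑ μ, (a μ + b μ)‖ := by
    rw [norm_mul, norm_neg, norm_div, norm_one, Complex.norm_two]
  have h1 : ‖∑ μ, (a μ + b μ)‖ ≤ ∑ μ, (‖a μ‖ + ‖b μ‖) :=
    (norm_sum_le _ _).trans (Finset.sum_le_sum fun μ _ => norm_add_le _ _)
  have h2 : (∑ μ, (‖a μ‖ + ‖b μ‖)) ^ 2 ≤ 4 * ∑ μ, (‖a μ‖ + ‖b μ‖) ^ 2 := by
    simpa using sq_sum_le_card_mul_sum_sq (s := Finset.univ) (f := fun μ : Fin 4 => ‖a μ‖ + ‖b μ‖)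
  have h3 : ∀ μ, (‖a μ‖ + ‖b μ‖) ^ 2 ≤ 2 * (‖a μ‖ ^ 2 + ‖b μ‖ ^ 2) := fun μ => by
    nlinarith [sq_nonneg (‖a μ‖ - ‖b μ‖)]
  rw [h0]
  calc (1 / 2 * ‖∑ μ, (a μ + b μ)‖) ^ 2 = 1 / 4 * ‖∑ μ, (a μ + b μ)‖ ^ 2 := by ring
    _ ≤ 1 / 4 * (∑ μ, (‖a μ‖ + ‖b μ‖)) ^ 2 := by gcongr
    _ ≤ 1 / 4 * (4 * ∑ μ, (‖a μ‖ + ‖b μ‖) ^ 2) := by gcongr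
    _ = ∑ μ, (‖a μ‖ + ‖b μ‖) ^ 2 := by ring
    _ ≤ ∑ μ, 2 * (‖a μ‖ ^ 2 + ‖b μ‖ ^ 2) := Finset.sum_le_sum fun μ _ => h3 μ
    _ = 2 * ∑ μ, (‖a μ‖ ^ 2 + ‖b μ‖ ^ 2) := by rw [Finset.mul_sum]

/-- `Σ_p Σ_q c Σ_μ h_μ(p,q) = c Σ_μ Σ_p Σ_q h_μ(p,q)`. -/
theorem sum_sum_const_mul_sum_comm {ι κ : Type*} [Fintype ι] [Fintype κ] (c : ℝ)
    (h : κ → ι → ι → ℝ) :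
    ∑ p, ∑ q, c * ∑ μ, h μ p q = c * ∑ μ, ∑ p, ∑ q, h μ p q := by
  have : ∀ p : ι, ∑ q, c * ∑ μ, h μ p q = c * ∑ μ, ∑ q, h μ p q := fun p => by
    rw [← Finset.mul_sum, Finset.sum_comm]
  simp_rw [this]
  rw [← Finset.mul_sum, Finset.sum_comm]

/-- Frobenius sum of a colour–spin block `(t, s) ↦ G_{t₂ s₂} C_{t₁ s₁}`: `‖G‖_F² ‖C‖_F²`. -/
theorem sum_norm_sq_block (G : Matrix (Fin 4) (Fin 4) ℂ) (C : Matrix (Fin 3) (Fin 3) ℂ) :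
    ∑ t : Fin 3 × Fin 4, ∑ s : Fin 3 × Fin 4, ‖G t.2 s.2 * C t.1 s.1‖ ^ 2 =
      (∑ α, ∑ β, ‖G α β‖ ^ 2) * ∑ a, ∑ b, ‖C a b‖ ^ 2 := by
  simp only [Fintype.sum_prod_type, norm_mul, mul_pow, Finset.sum_mul_sum]
  rw [Finset.sum_comm]
  refine Finset.sum_congr rfl fun α _ => Finset.sum_congr rfl fun a _ => ?_
  rw [Finset.sum_comm]

/-- Cauchy–Schwarz for a colour–spin block acting on a colour–spin vector:
`Σ_t ‖Σ_s G_{t₂ s₂} C_{t₁ s₁} w_s‖² ≤ ‖G‖_F² ‖C‖_F² Σ_s ‖w_s‖²`. -/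
theorem sum_norm_sq_block_mul_le (G : Matrix (Fin 4) (Fin 4) ℂ) (C : Matrix (Fin 3) (Fin 3) ℂ)
    (w : Fin 3 × Fin 4 → ℂ) :
    ∑ t : Fin 3 × Fin 4, ‖∑ s : Fin 3 × Fin 4, G t.2 s.2 * C t.1 s.1 * w s‖ ^ 2 ≤
      (∑ α, ∑ β, ‖G α β‖ ^ 2) * (∑ a, ∑ b, ‖C a b‖ ^ 2) * ∑ s, ‖w s‖ ^ 2 := by
  rw [← sum_norm_sq_block, Finset.sum_mul]
  refine Finset.sum_le_sum fun t _ => ?_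
  calc ‖∑ s : Fin 3 × Fin 4, G t.2 s.2 * C t.1 s.1 * w s‖ ^ 2
      ≤ (∑ s : Fin 3 × Fin 4, ‖G t.2 s.2 * C t.1 s.1‖ * ‖w s‖) ^ 2 :=
        pow_le_pow_left₀ (norm_nonneg _) ((norm_sum_le _ _).trans
          (le_of_eq (Finset.sum_congr rfl fun s _ => norm_mul _ _))) 2
    _ ≤ (∑ s : Fin 3 × Fin 4, ‖G t.2 s.2 * C t.1 s.1‖ ^ 2) * ∑ s, ‖w s‖ ^ 2 :=
        Finset.sum_mul_sq_le_sq_mul_sq _ _ _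

/-- Forward blocks on a vector: the column sum picks the site `y`. -/
theorem sum_ite_site_mul [NeZero L] (y : TorusSite 4 L) (g : Fin 3 × Fin 4 → ℂ)
    (v : TorusSite 4 L × Fin 3 × Fin 4 → ℂ) :
    ∑ q : TorusSite 4 L × Fin 3 × Fin 4, (if q.1 = y then g q.2 else 0) * v q =
      ∑ s, g s * v (y, s) := by
  rw [Fintype.sum_prod_type, Finset.sum_eq_single y (fun x _ hx => by simp [hx]) (by simp)]
  simp

/-- Backward blocks on a vector: the column sum picks the site `x − e_μ`. -/
theorem sum_ite_shift_mul [NeZero L] (x : TorusSite 4 L) (μ : Fin 4)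
    (g : TorusSite 4 L → Fin 3 × Fin 4 → ℂ) (v : TorusSite 4 L × Fin 3 × Fin 4 → ℂ) :
    ∑ q : TorusSite 4 L × Fin 3 × Fin 4, (if x = Site.shift q.1 μ then g q.1 q.2 else 0) * v q =
      ∑ s, g (x - Pi.single μ 1) s * v (x - Pi.single μ 1, s) := by
  simp_rw [eq_shift_iff' x]
  rw [Fintype.sum_prod_type,
    Finset.sum_eq_single (x - Pi.single μ 1) (fun y _ hy => by simp [hy]) (by simp)]
  simp

/-- Forward blocks: the Frobenius column sum picks the site `y`. -/
theorem sum_norm_sq_ite_site [NeZero L] (y : TorusSite 4 L) (g : Fin 3 × Fin 4 → ℂ) :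
    ∑ q : TorusSite 4 L × Fin 3 × Fin 4, ‖(if q.1 = y then g q.2 else 0)‖ ^ 2 =
      ∑ s, ‖g s‖ ^ 2 := by
  rw [Fintype.sum_prod_type, Finset.sum_eq_single y (fun x _ hx => by simp [hx]) (by simp)]
  simp

/-- Backward blocks: the Frobenius column sum picks the site `x − e_μ`. -/
theorem sum_norm_sq_ite_shift [NeZero L] (x : TorusSite 4 L) (μ : Fin 4)
    (g : TorusSite 4 L → Fin 3 × Fin 4 → ℂ) :
    ∑ q : TorusSite 4 L × Fin 3 × Fin 4, ‖(if x = Site.shift q.1 μ then g q.1 q.2 else 0)‖ ^ 2 =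
      ∑ s, ‖g (x - Pi.single μ 1) s‖ ^ 2 := by
  simp_rw [eq_shift_iff' x]
  rw [Fintype.sum_prod_type,
    Finset.sum_eq_single (x - Pi.single μ 1) (fun y _ hy => by simp [hy]) (by simp)]
  simp

/-- **Frobenius sum of a hopping kernel.**  For spin factors `G⁻_μ, G⁺_μ` and site-dependent colour
factors `C^f_μ, C^b_μ`, the kernel `K(p,q) = −½ Σ_μ ([q.1 = p.1 + e_μ] G⁻_μ ⊗ C^f_μ(p.1) +
[p.1 = q.1 + e_μ] G⁺_μ ⊗ C^b_μ(q.1))` has `‖K‖_F² ≤ 2 Σ_μ (‖G⁻_μ‖_F² Σ_x ‖C^f_μ(x)‖_F² +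
‖G⁺_μ‖_F² Σ_x ‖C^b_μ(x)‖_F²)`. -/
theorem frob_kernel_le [NeZero L] (Gm Gp : Fin 4 → Matrix (Fin 4) (Fin 4) ℂ)
    (Cf Cb : Fin 4 → TorusSite 4 L → Matrix (Fin 3) (Fin 3) ℂ) :
    ∑ p : TorusSite 4 L × Fin 3 × Fin 4, ∑ q : TorusSite 4 L × Fin 3 × Fin 4,
      ‖-(1 / 2 : ℂ) * ∑ μ, ((if q.1 = Site.shift p.1 μ then
          Gm μ p.2.2 q.2.2 * Cf μ p.1 p.2.1 q.2.1 else 0) +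
        (if p.1 = Site.shift q.1 μ then Gp μ p.2.2 q.2.2 * Cb μ q.1 p.2.1 q.2.1 else 0))‖ ^ 2 ≤
      2 * ∑ μ, ((∑ α, ∑ β, ‖Gm μ α β‖ ^ 2) * ∑ x, ∑ a, ∑ b, ‖Cf μ x a b‖ ^ 2 +
        (∑ α, ∑ β, ‖Gp μ α β‖ ^ 2) * ∑ x, ∑ a, ∑ b, ‖Cb μ x a b‖ ^ 2) := by
  have hF : ∀ μ, ∑ p : TorusSite 4 L × Fin 3 × Fin 4, ∑ q : TorusSite 4 L × Fin 3 × Fin 4,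
      ‖(if q.1 = Site.shift p.1 μ then Gm μ p.2.2 q.2.2 * Cf μ p.1 p.2.1 q.2.1 else 0)‖ ^ 2 =
        (∑ α, ∑ β, ‖Gm μ α β‖ ^ 2) * ∑ x, ∑ a, ∑ b, ‖Cf μ x a b‖ ^ 2 := fun μ => by
    have hx : ∀ x : TorusSite 4 L, ∑ t : Fin 3 × Fin 4, ∑ q : TorusSite 4 L × Fin 3 × Fin 4,
        ‖(if q.1 = Site.shift x μ then Gm μ t.2 q.2.2 * Cf μ x t.1 q.2.1 else 0)‖ ^ 2 =
          (∑ α, ∑ β, ‖Gm μ α β‖ ^ 2) * ∑ a, ∑ b, ‖Cf μ x a b‖ ^ 2 := fun x => by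
      rw [← sum_norm_sq_block]
      exact Finset.sum_congr rfl fun t _ =>
        sum_norm_sq_ite_site (Site.shift x μ) (fun s => Gm μ t.2 s.2 * Cf μ x t.1 s.1)
    rw [Fintype.sum_prod_type]
    simp only [hx]
    rw [Finset.mul_sum]
  have hB : ∀ μ, ∑ p : TorusSite 4 L × Fin 3 × Fin 4, ∑ q : TorusSite 4 L × Fin 3 × Fin 4,
      ‖(if p.1 = Site.shift q.1 μ then Gp μ p.2.2 q.2.2 * Cb μ q.1 p.2.1 q.2.1 else 0)‖ ^ 2 =
        (∑ α, ∑ β, ‖Gp μ α β‖ ^ 2) * ∑ x, ∑ a, ∑ b, ‖Cb μ x a b‖ ^ 2 := fun μ => by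
    have hx : ∀ x : TorusSite 4 L, ∑ t : Fin 3 × Fin 4, ∑ q : TorusSite 4 L × Fin 3 × Fin 4,
        ‖(if x = Site.shift q.1 μ then Gp μ t.2 q.2.2 * Cb μ q.1 t.1 q.2.1 else 0)‖ ^ 2 =
          (∑ α, ∑ β, ‖Gp μ α β‖ ^ 2) * ∑ a, ∑ b, ‖Cb μ (x - Pi.single μ 1) a b‖ ^ 2 :=
      fun x => by
      rw [← sum_norm_sq_block]
      exact Finset.sum_congr rfl fun t _ =>
        sum_norm_sq_ite_shift x μ (fun y s => Gp μ t.2 s.2 * Cb μ y t.1 s.1)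
    rw [Fintype.sum_prod_type]
    simp only [hx]
    rw [Finset.mul_sum]
    exact Equiv.sum_comp (Equiv.subRight (Pi.single μ (1 : ZMod L)))
      (fun x => (∑ α, ∑ β, ‖Gp μ α β‖ ^ 2) * ∑ a, ∑ b, ‖Cb μ x a b‖ ^ 2)
  refine (Finset.sum_le_sum fun p _ => Finset.sum_le_sum fun q _ =>
    norm_sq_half_sum_le _ _).trans (le_of_eq ?_)
  rw [sum_sum_const_mul_sum_comm]
  congr 1
  refine Finset.sum_congr rfl fun μ _ => ?_
  rw [← hF μ, ← hB μ]
  simp_rw [Finset.sum_add_distrib]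

/-- **A hopping kernel on a vector.**  If every block has `‖G^∓_μ‖_F² ‖C_μ(x)‖_F² ≤ K`, then
`Σ_p ‖(K v)_p‖² ≤ 16 K Σ_p ‖v_p‖²` (blockwise Cauchy–Schwarz; translations are bijections). -/
theorem op_kernel_le [NeZero L] (Gm Gp : Fin 4 → Matrix (Fin 4) (Fin 4) ℂ)
    (Cf Cb : Fin 4 → TorusSite 4 L → Matrix (Fin 3) (Fin 3) ℂ) (K : ℝ)
    (hKf : ∀ μ x, (∑ α, ∑ β, ‖Gm μ α β‖ ^ 2) * ∑ a, ∑ b, ‖Cf μ x a b‖ ^ 2 ≤ K)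
    (hKb : ∀ μ x, (∑ α, ∑ β, ‖Gp μ α β‖ ^ 2) * ∑ a, ∑ b, ‖Cb μ x a b‖ ^ 2 ≤ K)
    (v : TorusSite 4 L × Fin 3 × Fin 4 → ℂ) :
    ∑ p : TorusSite 4 L × Fin 3 × Fin 4, ‖∑ q : TorusSite 4 L × Fin 3 × Fin 4,
      (-(1 / 2 : ℂ) * ∑ μ, ((if q.1 = Site.shift p.1 μ then
          Gm μ p.2.2 q.2.2 * Cf μ p.1 p.2.1 q.2.1 else 0) +
        (if p.1 = Site.shift q.1 μ then Gp μ p.2.2 q.2.2 * Cb μ q.1 p.2.1 q.2.1 else 0))) *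
        v q‖ ^ 2 ≤
      16 * K * ∑ i, ‖v i‖ ^ 2 := by
  -- the kernel applied to `v`, site sums collapsed
  have hmv : ∀ p : TorusSite 4 L × Fin 3 × Fin 4, ∑ q : TorusSite 4 L × Fin 3 × Fin 4,
      (-(1 / 2 : ℂ) * ∑ μ, ((if q.1 = Site.shift p.1 μ then
          Gm μ p.2.2 q.2.2 * Cf μ p.1 p.2.1 q.2.1 else 0) +
        (if p.1 = Site.shift q.1 μ then Gp μ p.2.2 q.2.2 * Cb μ q.1 p.2.1 q.2.1 else 0))) *
        v q =
      -(1 / 2 : ℂ) * ∑ μ,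
        ((∑ s : Fin 3 × Fin 4, Gm μ p.2.2 s.2 * Cf μ p.1 p.2.1 s.1 * v (Site.shift p.1 μ, s)) +
          ∑ s : Fin 3 × Fin 4, Gp μ p.2.2 s.2 * Cb μ (p.1 - Pi.single μ 1) p.2.1 s.1 *
            v (p.1 - Pi.single μ 1, s)) := by
    intro p
    simp_rw [mul_assoc (-(1 / 2 : ℂ)), ← Finset.mul_sum]
    congr 1
    simp_rw [Finset.sum_mul, add_mul]
    rw [Finset.sum_comm]
    refine Finset.sum_congr rfl fun μ _ => ?_
    rw [Finset.sum_add_distrib,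
      sum_ite_site_mul (Site.shift p.1 μ) (fun s => Gm μ p.2.2 s.2 * Cf μ p.1 p.2.1 s.1) v,
      sum_ite_shift_mul p.1 μ (fun y s => Gp μ p.2.2 s.2 * Cb μ y p.2.1 s.1) v]
  -- the forward blocks
  have hAf : ∀ μ, ∑ p : TorusSite 4 L × Fin 3 × Fin 4,
      ‖∑ s : Fin 3 × Fin 4, Gm μ p.2.2 s.2 * Cf μ p.1 p.2.1 s.1 * v (Site.shift p.1 μ, s)‖ ^ 2 ≤
        K * ∑ i, ‖v i‖ ^ 2 := fun μ => by
    rw [Fintype.sum_prod_type]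
    dsimp only
    refine (Finset.sum_le_sum fun x _ =>
      (sum_norm_sq_block_mul_le (Gm μ) (Cf μ x) (fun s => v (Site.shift x μ, s))).trans
        (mul_le_mul_of_nonneg_right (hKf μ x) (Finset.sum_nonneg fun s _ => sq_nonneg _))).trans
      (le_of_eq ?_)
    rw [← Finset.mul_sum]
    congr 1
    rw [Fintype.sum_prod_type]
    exact Equiv.sum_comp (Equiv.addRight (Pi.single μ (1 : ZMod L)))
      (fun x => ∑ s : Fin 3 × Fin 4, ‖v (x, s)‖ ^ 2)
  -- the backward blocks
  have hAb : ∀ μ, ∑ p : TorusSite 4 L × Fin 3 × Fin 4,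
      ‖∑ s : Fin 3 × Fin 4, Gp μ p.2.2 s.2 * Cb μ (p.1 - Pi.single μ 1) p.2.1 s.1 *
        v (p.1 - Pi.single μ 1, s)‖ ^ 2 ≤ K * ∑ i, ‖v i‖ ^ 2 := fun μ => by
    rw [Fintype.sum_prod_type]
    dsimp only
    refine (Finset.sum_le_sum fun x _ =>
      (sum_norm_sq_block_mul_le (Gp μ) (Cb μ (x - Pi.single μ 1))
        (fun s => v (x - Pi.single μ 1, s))).trans
        (mul_le_mul_of_nonneg_right (hKb μ (x - Pi.single μ 1))
          (Finset.sum_nonneg fun s _ => sq_nonneg _))).trans (le_of_eq ?_)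
    rw [← Finset.mul_sum]
    congr 1
    rw [Fintype.sum_prod_type]
    exact Equiv.sum_comp (Equiv.subRight (Pi.single μ (1 : ZMod L)))
      (fun x => ∑ s : Fin 3 × Fin 4, ‖v (x, s)‖ ^ 2)
  simp_rw [hmv]
  refine (Finset.sum_le_sum fun p _ => norm_sq_half_sum_le _ _).trans ?_
  rw [← Finset.mul_sum, Finset.sum_comm]
  simp_rw [Finset.sum_add_distrib]
  refine (mul_le_mul_of_nonneg_left (add_le_add (Finset.sum_le_sum fun μ _ => hAf μ)
    (Finset.sum_le_sum fun μ _ => hAb μ)) (zero_le_two : (0 : ℝ) ≤ 2)).trans (le_of_eq ?_)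
  rw [Finset.sum_const, Finset.card_univ, Fintype.card_fin, nsmul_eq_mul]
  push_cast
  ring

/-- **(F) Frobenius bound**: `Σ_{pq} ‖Δ_{pq}‖² ≤ 64 Σ_e (3 − Re tr X_e)`. -/
theorem frobenius_le [NeZero L] (u : Fin 4 → Matrix.unitaryGroup (Fin 3) ℂ)
    (X : GaugeConfig 4 L (Matrix.unitaryGroup (Fin 3) ℂ)) (m : ℝ) :
    ∑ p, ∑ q, ‖(wilsonDirac (unitaryFundamentalRep (Fin 3) ℂ) (fun e : Edge 4 L => u e.2 * X e) m 1 -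
        wilsonDirac (unitaryFundamentalRep (Fin 3) ℂ) (fun e : Edge 4 L => u e.2) m 1) p q‖ ^ 2 ≤
      64 * ∑ e : Edge 4 L, (3 - ((X e : Matrix (Fin 3) (Fin 3) ℂ)).trace.re) := by
  have h := frob_kernel_le (L := L) (fun μ => (1 : Matrix (Fin 4) (Fin 4) ℂ) - euclideanGamma μ)
    (fun μ => (1 : Matrix (Fin 4) (Fin 4) ℂ) + euclideanGamma μ)
    (fun μ x => unitaryFundamentalRep (Fin 3) ℂ (u μ * X (x, μ)) -
      unitaryFundamentalRep (Fin 3) ℂ (u μ))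
    (fun μ y => unitaryFundamentalRep (Fin 3) ℂ (u μ * X (y, μ))⁻¹ -
      unitaryFundamentalRep (Fin 3) ℂ (u μ)⁻¹)
  simp only [sum_norm_sq_one_sub_gamma, sum_norm_sq_one_add_gamma, sum_norm_sq_rep_mul_sub,
    sum_norm_sq_rep_mul_inv_sub] at h
  simp_rw [wilsonDirac_dir_sub_apply]
  refine h.trans (le_of_eq ?_)
  rw [Fintype.sum_prod_type, Finset.sum_comm, Finset.mul_sum, Finset.mul_sum]
  refine Finset.sum_congr rfl fun μ _ => ?_
  rw [← Finset.mul_sum]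
  ring

/-- **(op) Operator bound**: if every link deficit is `≤ η`, then
`Σ_p ‖(Δ v)_p‖² ≤ 256 η Σ_p ‖v_p‖²`. -/
theorem op_le [NeZero L] (u : Fin 4 → Matrix.unitaryGroup (Fin 3) ℂ)
    (X : GaugeConfig 4 L (Matrix.unitaryGroup (Fin 3) ℂ)) (m η : ℝ)
    (hη : ∀ e, 3 - ((X e : Matrix.unitaryGroup (Fin 3) ℂ) : Matrix (Fin 3) (Fin 3) ℂ).trace.re ≤ η)
    (v : TorusSite 4 L × Fin 3 × Fin 4 → ℂ) :
    ∑ p, ‖((wilsonDirac (unitaryFundamentalRep (Fin 3) ℂ) (fun e : Edge 4 L => u e.2 * X e) m 1 -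
        wilsonDirac (unitaryFundamentalRep (Fin 3) ℂ) (fun e : Edge 4 L => u e.2) m 1).mulVec v) p‖ ^ 2 ≤
      256 * η * ∑ i, ‖v i‖ ^ 2 := by
  have hKf : ∀ (μ : Fin 4) (x : TorusSite 4 L),
      (∑ α, ∑ β, ‖((1 : Matrix (Fin 4) (Fin 4) ℂ) - euclideanGamma μ) α β‖ ^ 2) *
        ∑ a, ∑ b, ‖(unitaryFundamentalRep (Fin 3) ℂ (u μ * X (x, μ)) -
          unitaryFundamentalRep (Fin 3) ℂ (u μ)) a b‖ ^ 2 ≤ 16 * η := fun μ x => by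
    rw [sum_norm_sq_one_sub_gamma, sum_norm_sq_rep_mul_sub]
    have := hη (x, μ)
    linarith
  have hKb : ∀ (μ : Fin 4) (x : TorusSite 4 L),
      (∑ α, ∑ β, ‖((1 : Matrix (Fin 4) (Fin 4) ℂ) + euclideanGamma μ) α β‖ ^ 2) *
        ∑ a, ∑ b, ‖(unitaryFundamentalRep (Fin 3) ℂ (u μ * X (x, μ))⁻¹ -
          unitaryFundamentalRep (Fin 3) ℂ (u μ)⁻¹) a b‖ ^ 2 ≤ 16 * η := fun μ x => by
    rw [sum_norm_sq_one_add_gamma, sum_norm_sq_rep_mul_inv_sub]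
    have := hη (x, μ)
    linarith
  have h := op_kernel_le (L := L) (fun μ => (1 : Matrix (Fin 4) (Fin 4) ℂ) - euclideanGamma μ)
    (fun μ => (1 : Matrix (Fin 4) (Fin 4) ℂ) + euclideanGamma μ)
    (fun μ x => unitaryFundamentalRep (Fin 3) ℂ (u μ * X (x, μ)) -
      unitaryFundamentalRep (Fin 3) ℂ (u μ))
    (fun μ y => unitaryFundamentalRep (Fin 3) ℂ (u μ * X (y, μ))⁻¹ -
      unitaryFundamentalRep (Fin 3) ℂ (u μ)⁻¹) (16 * η) hKf hKb v
  simp only [Matrix.mulVec, dotProduct]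
  simp_rw [wilsonDirac_dir_sub_apply]
  refine h.trans (le_of_eq ?_)
  ring

end StubDeltaBounds

/-- **Stub 3d — `deltaBounds`.**  On the `2⁴`-torus, for constant direction-dependent unitaries
`u_μ ∈ U(3)` and any `U(3)` field `X`, the perturbation `Δ = D₂[u·X] − D₂[u]` of the `r = 1`
Wilson–Dirac operator obeys the Frobenius bound `Σ_{ij} ‖Δ_{ij}‖² ≤ C_F Σ_e (3 − Re tr X_e)` and
the operator bound `Σ_i ‖(Δ v)_i‖² ≤ C_op η Σ_i ‖v_i‖²` whenever all link deficits are `≤ η`;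
here with `C_F = 64`, `C_op = 256` (`StubDeltaBounds.frobenius_le`, `StubDeltaBounds.op_le`). -/
theorem stub_deltaBounds :
    ∃ CF Cop : ℝ, ∀ (m : ℝ) (u : Fin 4 → Matrix.unitaryGroup (Fin 3) ℂ) (X : GaugeConfig 4 2 (Matrix.unitaryGroup (Fin 3) ℂ))
      (η : ℝ), (∀ e, 3 - ((X e : Matrix.unitaryGroup (Fin 3) ℂ) : Matrix (Fin 3) (Fin 3) ℂ).trace.re ≤ η) →
      let Δ := wilsonDirac (unitaryFundamentalRep (Fin 3) ℂ) (fun e : Edge 4 2 => u e.2 * X e) m 1 -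
        wilsonDirac (unitaryFundamentalRep (Fin 3) ℂ) (fun e : Edge 4 2 => u e.2) m 1;
      (∑ i, ∑ j, ‖Δ i j‖ ^ 2 ≤
          CF * ∑ e : Edge 4 2, (3 - ((X e : Matrix.unitaryGroup (Fin 3) ℂ) : Matrix (Fin 3) (Fin 3) ℂ).trace.re)) ∧
        ∀ v : TorusSite 4 2 × Fin 3 × Fin 4 → ℂ, ∑ i, ‖(Δ.mulVec v) i‖ ^ 2 ≤ Cop * η * ∑ i, ‖v i‖ ^ 2 := by
  exact ⟨64, 256, fun m u X η hη =>
    ⟨StubDeltaBounds.frobenius_le u X m, fun v => StubDeltaBounds.op_le u X m η hη v⟩⟩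

end Summit.QuantumFields.QCD.Cruxes.CriticalLineDiamagnetism.ChessboardCellGain

end
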